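import Literature.Analysis.FluidPDE.ConfinedHardSphereFlow
import Literature.Analysis.FluidPDE.HardSphereFlowConstruction
import Literature.Analysis.FluidPDE.ConfinedHardSphereTrajectoryProofs
import HarnessLib

/-!
# The event-by-event construction of the confined hard-sphere flow (spheres among fixed specular obstacles)

`Literature.Analysis.FluidPDE.ConfinedHardSphereFlow` records the existence of the CONFINED
hard-sphere flow — `N` spheres of diameter `ε` moving by free flight, elastic binary collisions
and specular reflections at fixed obstacles `W : ι → Wall d X` — on the flat torus among finitely
many separated round scatterers as the named fact
`ConfinedHardSphereFlow.nonempty_torus_balls` (Cercignani–Illner–Pulvirenti 1994, Thm. 4.2.1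
with App. 4.A p. 111: "The cases of reflecting boundary conditions […] can be treated
similarly"; Alexander 1975). This file is the first layer of its proof, the exact analogue, with
a second kind of event, of `Literature.Analysis.FluidPDE.HardSphereFlowConstruction` (the
wall-free construction behind `HardSphereFlow.nonempty_torus_holds`): it *constructs* the
candidate flow explicitly for an arbitrary geometry and wall family — free flight up to the exit
time from the CONFINED domain, then the elastic reflection of the incoming contact pair OR the
specular reflection of the incoming sphere–wall contact, iterated; backward in time by the
velocity flip (CIP 1994 (2.3)) — and defines its good set `Γ₀`.

* `ConfinedAlexander.exitTime G W ε z : ℝ≥0∞` — `τ(z) = inf {t ≥ 0 | S_t z ∉ confinedDomain}`,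
  the first exit time of the free flight from the (closed) confined domain (`∞` if never).
* `ConfinedAlexander.incomingWalls W z` — the sphere–wall contacts `(i, k)` of `z` with
  wall-incoming velocity (`⟪vᵢ, n⟫ < 0`); the incoming contact PAIRS are
  `Alexander.incomingPairs G ε z` of the wall-free construction.
* `ConfinedAlexander.eventStep G W ε` — free flight for time `τ(z)`, then `collidePair` of an
  incoming contact pair if there is one, else `reflectWall` of an incoming sphere–wall contact if
  there is one (the identity if `τ(z) = ∞`).
* `ConfinedAlexander.stateAfter`, `eventInstant`, `eventCount`, `eventCountBefore`, `fwdFlow`,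
  `fwdFlowLeft`, `flow` — the `k`-th post-event state `z_k = T^k z`, the `k`-th event instant
  `t_k = ∑_{m<k} τ(z_m)`, the number of events in `[0, t]` resp. `[0, t)`, the forward flow
  `S_{t - t_k} z_k` on `[t_k, t_{k+1})` (right-continuous), its left-continuous version, and the
  two-sided flow (`T^{-t} = S T^t S`, CIP 1994 (2.3)), verbatim as in the wall-free file.
* `ConfinedAlexander.IsSimplePairEvent`, `IsSimpleWallEvent`, `IsSimpleEvent`, `FwdGood`, `good` —
  the good set `Γ₀`: every forward event of `z` and of `flipVel z` is SIMPLE (exactly one pair in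
  contact, incoming, and no sphere on a wall; or exactly one sphere on exactly one wall,
  wall-incoming, and no pair in contact), no contact of either kind strictly inside a free-flight
  segment (no grazing touch), the event instants do not accumulate, and at time `0` the contacts
  of `z` (at most one event's worth) are outgoing (right-continuity convention of
  `IsConfinedHardSphereTrajectory`).

The five properties of this construction on the torus among separated round scatterers (group
property, orbits are confined trajectories, measurability, `Γ₀` conull, Liouville measure
preserved) are proved in the sibling files `ConfinedHardSphereFlow{Orbits,Group,Measurable,
Restart,ShortTime,Scattering,Alexander}`; here only the construction and its elementary API.

## Mathlib / Literature reuse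

Everything static (`confinedDomain`, `Wall`, `reflectWall`, `IsWallIncoming`, `IsWallOutgoing`,
`contactSet`, `IsIncoming`, `IsOutgoing`, `freeFlight`, `collidePair`, `flipVel`) is
`ConfinedHardSphereFlow`'s / `HardSpherePhaseSpace`'s / `HardSphereDynamics`'; the incoming
contact pairs `Alexander.incomingPairs` and the simple incoming pair configurations
`Alexander.IsSimpleIncoming` are the wall-free construction's (`HardSphereFlowConstruction`), so
that its pair API (`HardSphereFlowOrbits`) can be reused verbatim. Times live in `ℝ≥0∞`.

## Design choices

* Identical conventions to `HardSphereFlowConstruction` (see there): total junk-valued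
  definitions, `Set.Nonempty.some` for the event selection (no choice on the good set, where the
  event is unique), `sSup` counting with junk value `0` on Zeno orbits, algebraic left-continuous
  forward flow for the backward orbits (no topology in the definitions).
* Pair events take precedence over wall events in `eventStep`; on the good set at most one kind
  is present at an event, so the order is immaterial there.
* The construction is stated for an arbitrary `Geometry` and an arbitrary wall family; the
  theorems about it (sibling files) are for the torus with round scatterers `Wall.ball`.

## References

* C. Cercignani, R. Illner, M. Pulvirenti, *The Mathematical Theory of Dilute Gases*, Springer
  (1994), §4.2 (pp. 64–65: domain `Λ`, reflection law (2.2), Thm. 4.2.1, the flow `T^t` on `Γ₀`,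
  (2.3)), Appendix 4.A (pp. 107–111; p. 111: reflecting boundary conditions).
* R. K. Alexander, *The infinite hard sphere system*, PhD thesis, UC Berkeley (1975).
* I. Gallagher, L. Saint-Raymond, B. Texier, *From Newton to Boltzmann* (2013), §4.1.
-/

open MeasureTheory Set Filter Function
open scoped ENNReal Topology

namespace Literature.Analysis.FluidPDE

noncomputable section

section Kinetic

variable {d : Type*} [Fintype d] {X : Type*} {N : ℕ} {ι : Type*}

namespace ConfinedAlexander

variable (G : Geometry d X) (W : ι → Wall d X) (ε : ℝ)

/-! ## One event step -/

/-- The first exit time of the free flight from the closed CONFINED domain: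
`τ(z) = inf {t ≥ 0 | S_t z ∉ confinedDomain G W N ε} ∈ [0, ∞]` (`∞` if the free flight never
leaves it). For `z` in the confined domain this is the time of the next event — pair collision
or wall reflection (CIP 1994 App. 4.A, the ceiling function `a(y)`, p. 108, "the first time at
which there is a new collision", p. 111, boundary included). [cite: CIP1994, App. 4.A p. 108] -/
def exitTime (z : Config N d X) : ℝ≥0∞ :=
  sInf {t : ℝ≥0∞ | t ≠ ∞ ∧ freeFlight G t.toReal z ∉ confinedDomain G W N ε}

/-- The sphere–wall contacts `(i, k)` of `z` — centre `xᵢ` on the wall `k` — with wall-incoming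
velocity `⟪vᵢ, n(xᵢ)⟫ < 0` (CIP 1994 §4.2 (2.2): "If a particle hits `∂Λ` at a point `x` with
velocity `ξᵢ`, it gets reflected"). [cite: CIP1994, §4.2 (2.2)] -/
def incomingWalls (z : Config N d X) : Set (Fin N × ι) :=
  {q | (z q.1).1 ∈ (W q.2).contact ∧ IsWallIncoming (W q.2) z q.1}

variable {W} in
/-- Membership in `incomingWalls`. [folklore] -/
theorem mem_incomingWalls {z : Config N d X} {q : Fin N × ι} :
    q ∈ incomingWalls W z ↔ (z q.1).1 ∈ (W q.2).contact ∧ IsWallIncoming (W q.2) z q.1 :=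
  Iff.rfl

open Classical in
/-- The RESOLUTION OF AN EVENT at the configuration `z` (CIP 1994 §4.2 (2.1)–(2.2): the
collision transformation, resp. the reflection at the boundary): the elastic reflection
`collidePair` of an incoming contact pair of `z` if there is one, otherwise the specular
reflection `reflectWall` of an incoming sphere–wall contact if there is one, otherwise `z`
itself. On the good set exactly one event is present at an event instant, so
`Set.Nonempty.some` makes no choice there. [cite: CIP1994, §4.2 (2.1)–(2.2)] -/
def eventJump (z : Config N d X) : Config N d X :=
  if h : (Alexander.incomingPairs G ε z).Nonempty then collidePair G h.some.1 h.some.2 z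
  else if h' : (incomingWalls W z).Nonempty then reflectWall (W h'.some.2) h'.some.1 z
  else z

/-- One step of the confined hard-sphere dynamics (CIP 1994 §4.2 p. 65 and App. 4.A p. 111, the
boundary map composed with the reflection): free flight for the exit time `τ(z)`, then the
resolution `eventJump` of the event reached. If `τ(z) = ∞` (no further event) the step is the
identity. [cite: CIP1994, §4.2 p. 65] -/
def eventStep (z : Config N d X) : Config N d X :=
  if exitTime G W ε z = ∞ then z else eventJump G W ε (freeFlight G (exitTime G W ε z).toReal z)

/-! ## Iteration: post-event states, event instants, the forward flow -/

/-- The `k`-th post-event state `z_k = T^k z` of the forward confined dynamics started at `z`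
(`z_0 = z`; CIP 1994 App. 4.A, iterates `T^k y`). [cite: CIP1994, App. 4.A p. 109] -/
def stateAfter (z : Config N d X) (k : ℕ) : Config N d X :=
  (eventStep G W ε)^[k] z

/-- The `k`-th event instant `t_k = ∑_{m < k} τ(z_m) ∈ [0, ∞]` of the forward confined dynamics
started at `z` (`t_0 = 0`; CIP 1994 App. 4.A, the partial sums `∑ a(T^k y)`). [cite: CIP1994, App. 4.A p. 109] -/
def eventInstant (z : Config N d X) (k : ℕ) : ℝ≥0∞ :=
  ∑ m ∈ Finset.range k, exitTime G W ε (stateAfter G W ε z m)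

/-- The number of events of the forward dynamics in the closed window `[0, t]`: the largest `k`
with `t_k ≤ t` (junk value `0` when the instants accumulate before `t`). [folklore] -/
def eventCount (z : Config N d X) (t : ℝ) : ℕ :=
  sSup {k : ℕ | eventInstant G W ε z k ≤ ENNReal.ofReal t}

/-- The number of events of the forward dynamics in the half-open window `[0, t)`: the largest
`k` with `t_k < t` (`0` if none; junk value `0` for accumulating instants). [folklore] -/
def eventCountBefore (z : Config N d X) (t : ℝ) : ℕ :=
  sSup {k : ℕ | eventInstant G W ε z k < ENNReal.ofReal t}

/-- The forward confined flow: `Φ_t z = S_{t - t_k} z_k` for `t ∈ [t_k, t_{k+1})`,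
`k = eventCount z t` — free flight from the last post-event state (right-continuous in `t`;
CIP 1994 §4.2 p. 65, "Eqs. (2.1), (2.2), and the free flow determine completely the time
evolution"). Meaningful for `t ≥ 0` and `z` in the good set. [cite: CIP1994, §4.2 p. 65] -/
def fwdFlow (z : Config N d X) (t : ℝ) : Config N d X :=
  freeFlight G (t - (eventInstant G W ε z (eventCount G W ε z t)).toReal)
    (stateAfter G W ε z (eventCount G W ε z t))

/-- The left-continuous version of the forward confined flow: `Φ_{t⁻} z = S_{t - t_k} z_k` for
`t ∈ (t_k, t_{k+1}]`, `k = eventCountBefore z t` — at an event instant the value is the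
PRE-event configuration, elsewhere it agrees with `fwdFlow`. [folklore] -/
def fwdFlowLeft (z : Config N d X) (t : ℝ) : Config N d X :=
  freeFlight G (t - (eventInstant G W ε z (eventCountBefore G W ε z t)).toReal)
    (stateAfter G W ε z (eventCountBefore G W ε z t))

/-- The two-sided confined flow `T^t` (CIP 1994 §4.2 p. 65 and (2.3): `T^{-t} = S T^t S` on
`Γ₀`, `S` the velocity flip): the forward flow for `t ≥ 0`, and for `t < 0` the velocity flip
of the left-continuous forward flow of `flipVel z` at time `-t` (this makes backward orbits
right-continuous, as `IsConfinedHardSphereTrajectory` requires). [cite: CIP1994, §4.2 (2.3)] -/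
def flow (t : ℝ) (z : Config N d X) : Config N d X :=
  if 0 ≤ t then fwdFlow G W ε z t else flipVel (fwdFlowLeft G W ε (flipVel z) (-t))

/-! ## The good set `Γ₀` -/

/-- `z` is a *simple pair-event configuration*: a simple incoming collision configuration of the
wall-free theory (`Alexander.IsSimpleIncoming`: one ordered pair `i < j` with incoming
velocities, and the pairs in contact are exactly `(i, j)`, `(j, i)`) in which moreover NO sphere
touches a wall (CIP 1994 §4.2 p. 65: "only pair collisions and hit the boundary `∂Λ` only in
isolated collisions"). [cite: CIP1994, §4.2 p. 65] -/
def IsSimplePairEvent (z : Config N d X) : Prop :=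
  Alexander.IsSimpleIncoming G ε z ∧ ∀ (i : Fin N) (k : ι), (z i).1 ∉ (W k).contact

/-- `z` is a *simple wall-event configuration*: some sphere `i` touches some wall `k` with
wall-incoming velocity, this is the only sphere–wall contact of `z`, and no pair is in contact
(CIP 1994 §4.2 p. 65: an isolated collision with the boundary). [cite: CIP1994, §4.2 p. 65] -/
def IsSimpleWallEvent (z : Config N d X) : Prop :=
  ∃ q : Fin N × ι, (z q.1).1 ∈ (W q.2).contact ∧ IsWallIncoming (W q.2) z q.1 ∧
    (∀ (i : Fin N) (k : ι), (z i).1 ∈ (W k).contact → i = q.1 ∧ k = q.2) ∧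
    ∀ i j : Fin N, i ≠ j → z ∉ contactSet G N ε i j

/-- `z` is a *simple event configuration*: a simple pair event or a simple wall event (the
configurations through which CIP 1994 §4.2 continue the flow). [cite: CIP1994, §4.2 p. 65] -/
def IsSimpleEvent (z : Config N d X) : Prop :=
  IsSimplePairEvent G W ε z ∨ IsSimpleWallEvent G W ε z

/-- Forward regularity of the event-by-event confined dynamics started at `z` (the negation of
CIP 1994 Thm. 4.2.1 (1)–(3), forward in time, in the right-continuous bookkeeping): (i) whenever
the `k`-th free flight ends (`τ(z_k) < ∞`) it ends in a simple event configuration; (ii)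
strictly inside each free-flight segment no pair is in contact and no sphere touches a wall (no
grazing touch); (iii) the event instants do not accumulate, `∑_k τ(z_k) = ∞`. [cite: CIP1994, Thm. 4.2.1] -/
def FwdGood (z : Config N d X) : Prop :=
  (∀ k, exitTime G W ε (stateAfter G W ε z k) ≠ ∞ →
      IsSimpleEvent G W ε
        (freeFlight G (exitTime G W ε (stateAfter G W ε z k)).toReal (stateAfter G W ε z k))) ∧
  (∀ k (t : ℝ), 0 < t → ENNReal.ofReal t < exitTime G W ε (stateAfter G W ε z k) →
      (∀ i j : Fin N, i ≠ j → freeFlight G t (stateAfter G W ε z k) ∉ contactSet G N ε i j) ∧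
      ∀ (i : Fin N) (k' : ι), (freeFlight G t (stateAfter G W ε z k) i).1 ∉ (W k').contact) ∧
  ∑' k, exitTime G W ε (stateAfter G W ε z k) = ∞

/-- The good set `Γ₀` of initial data of the confined dynamics (CIP 1994 §4.2 p. 65: "by deleting
the null sets defined in the theorem from phase space, we arrive at a set `Γ₀ ⊂ Λᴺ × ℝ³ᴺ` on
which the time evolution of every phase point `z` is globally defined backward and forward"), in
the right-continuous convention of `IsConfinedHardSphereTrajectory`: `z` is in the confined
domain; if a pair is in contact in `z` it is outgoing, the only pair in contact, and no sphere
touches a wall; if a sphere touches a wall in `z` it is wall-outgoing, the only sphere–wall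
contact, and no pair is in contact; and both `z` and its velocity flip are forward-good
(`FwdGood`; the backward evolution of `z` is the flipped forward evolution of `flipVel z`,
CIP 1994 (2.3)). [cite: CIP1994, §4.2 p. 65] -/
def good : Set (Config N d X) :=
  {z | z ∈ confinedDomain G W N ε ∧
    (∀ i j : Fin N, i ≠ j → z ∈ contactSet G N ε i j →
      IsOutgoing G z i j ∧
        (∀ i' j' : Fin N, i' ≠ j' → z ∈ contactSet G N ε i' j' →
          ({i', j'} : Finset (Fin N)) = {i, j}) ∧
        ∀ (i' : Fin N) (k : ι), (z i').1 ∉ (W k).contact) ∧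
    (∀ (i : Fin N) (k : ι), (z i).1 ∈ (W k).contact →
      IsWallOutgoing (W k) z i ∧
        (∀ (i' : Fin N) (k' : ι), (z i').1 ∈ (W k').contact → i' = i ∧ k' = k) ∧
        ∀ i' j' : Fin N, i' ≠ j' → z ∉ contactSet G N ε i' j') ∧
    FwdGood G W ε z ∧ FwdGood G W ε (flipVel z)}

/-! ## Elementary API -/

variable {G W ε}

/-- The good set lies in the confined domain. [folklore] -/
theorem good_subset_confinedDomain : good G W ε ⊆ confinedDomain G W N ε := fun _ hz => hz.1

/-- The good set lies in the hard-sphere domain. [folklore] -/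
theorem good_subset_hardSphereDomain : good G W ε ⊆ hardSphereDomain G N ε :=
  fun _ hz => (confinedDomain_subset G W N ε) hz.1

/-- If the free flight never leaves the confined domain, the event step is the identity. [folklore] -/
theorem eventStep_of_eq_top {z : Config N d X} (h : exitTime G W ε z = ∞) :
    eventStep G W ε z = z := by
  simp [eventStep, h]

/-- If the exit time is finite, the event step is the resolution of the event at the exit
configuration. [folklore] -/
theorem eventStep_of_ne_top {z : Config N d X} (h : exitTime G W ε z ≠ ∞) :
    eventStep G W ε z = eventJump G W ε (freeFlight G (exitTime G W ε z).toReal z) := by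
  simp [eventStep, h]

/-- With an incoming contact pair present, the event resolution is a pair collision. [folklore] -/
theorem eventJump_of_incomingPairs_nonempty {z : Config N d X}
    (h : (Alexander.incomingPairs G ε z).Nonempty) :
    eventJump G W ε z = collidePair G h.some.1 h.some.2 z := by
  rw [eventJump, dif_pos h]

/-- With no incoming contact pair but an incoming wall contact present, the event resolution is
a wall reflection. [folklore] -/
theorem eventJump_of_incomingWalls_nonempty {z : Config N d X}
    (h : ¬(Alexander.incomingPairs G ε z).Nonempty) (h' : (incomingWalls W z).Nonempty) :
    eventJump G W ε z = reflectWall (W h'.some.2) h'.some.1 z := by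
  rw [eventJump, dif_neg h, dif_pos h']

/-- With no incoming contact of either kind, the event resolution is the identity. [folklore] -/
theorem eventJump_of_not_nonempty {z : Config N d X}
    (h : ¬(Alexander.incomingPairs G ε z).Nonempty) (h' : ¬(incomingWalls W z).Nonempty) :
    eventJump G W ε z = z := by
  rw [eventJump, dif_neg h, dif_neg h']

/-- The resolution of an event does not move the spheres. [folklore] -/
@[simp]
theorem eventJump_apply_fst (z : Config N d X) (k : Fin N) : (eventJump G W ε z k).1 = (z k).1 := by
  by_cases h : (Alexander.incomingPairs G ε z).Nonempty
  · rw [eventJump_of_incomingPairs_nonempty h, collidePair_apply_fst]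
  by_cases h' : (incomingWalls W z).Nonempty
  · rw [eventJump_of_incomingWalls_nonempty h h', reflectWall_apply_fst]
  · rw [eventJump_of_not_nonempty h h']

/-- The resolution of an event preserves the hard-sphere domain. [folklore] -/
@[simp]
theorem eventJump_mem_hardSphereDomain_iff {z : Config N d X} :
    eventJump G W ε z ∈ hardSphereDomain G N ε ↔ z ∈ hardSphereDomain G N ε :=
  mem_hardSphereDomain_congr_fst fun k => eventJump_apply_fst z k

/-- The resolution of an event preserves the confined domain. [folklore] -/
@[simp]
theorem eventJump_mem_confinedDomain_iff {z : Config N d X} :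
    eventJump G W ε z ∈ confinedDomain G W N ε ↔ z ∈ confinedDomain G W N ε := by
  simp only [mem_confinedDomain, eventJump_mem_hardSphereDomain_iff, eventJump_apply_fst]

/-- The resolution of an event preserves pair contacts. [folklore] -/
theorem eventJump_mem_contactSet_iff {z : Config N d X} {i j : Fin N} :
    eventJump G W ε z ∈ contactSet G N ε i j ↔ z ∈ contactSet G N ε i j :=
  mem_contactSet_congr_fst fun k => eventJump_apply_fst z k

/-- If the free flight is outside the confined domain at a time `t ≥ 0`, the exit time is at most
`t`. [folklore] -/
theorem exitTime_le_of_not_mem {z : Config N d X} {t : ℝ} (ht : 0 ≤ t)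
    (h : freeFlight G t z ∉ confinedDomain G W N ε) : exitTime G W ε z ≤ ENNReal.ofReal t :=
  sInf_le ⟨ENNReal.ofReal_ne_top, by rwa [ENNReal.toReal_ofReal ht]⟩

/-- If the free flight stays in the confined domain at all times `t ≥ 0` with `t < c`, the exit
time is at least `c`. [folklore] -/
theorem le_exitTime_of_forall_mem {z : Config N d X} {c : ℝ≥0∞}
    (h : ∀ t : ℝ, 0 ≤ t → ENNReal.ofReal t < c → freeFlight G t z ∈ confinedDomain G W N ε) :
    c ≤ exitTime G W ε z := by
  refine le_sInf ?_
  rintro b ⟨hb, hmem⟩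
  by_contra hlt
  refine hmem (h _ ENNReal.toReal_nonneg ?_)
  rw [ENNReal.ofReal_toReal hb]
  exact not_le.1 hlt

/-- Before the exit time the free flight stays in the confined domain. [folklore] -/
theorem freeFlight_mem_confinedDomain_of_lt {z : Config N d X} {t : ℝ} (ht : 0 ≤ t)
    (h : ENNReal.ofReal t < exitTime G W ε z) : freeFlight G t z ∈ confinedDomain G W N ε := by
  by_contra hmem
  exact (not_le.2 h) (exitTime_le_of_not_mem ht hmem)

/-- A configuration with positive exit time lies in the confined domain. [folklore] -/
theorem mem_confinedDomain_of_exitTime_pos {z : Config N d X} (h : 0 < exitTime G W ε z) :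
    z ∈ confinedDomain G W N ε := by
  simpa using freeFlight_mem_confinedDomain_of_lt (G := G) (W := W) (ε := ε) (z := z) le_rfl
    (by simpa using h)

/-- The free flight never leaves the confined domain iff the exit time is infinite. [folklore] -/
theorem exitTime_eq_top_iff {z : Config N d X} :
    exitTime G W ε z = ∞ ↔ ∀ t : ℝ, 0 ≤ t → freeFlight G t z ∈ confinedDomain G W N ε := by
  constructor
  · intro h t ht
    exact freeFlight_mem_confinedDomain_of_lt ht (h ▸ ENNReal.ofReal_lt_top)
  · intro h
    rw [exitTime, sInf_eq_top]
    rintro t ⟨-, hmem⟩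
    exact (hmem (h _ ENNReal.toReal_nonneg)).elim

/-- `z_0 = z`. [folklore] -/
@[simp]
theorem stateAfter_zero (z : Config N d X) : stateAfter G W ε z 0 = z := rfl

/-- `z_{k+1} = T z_k`. [folklore] -/
theorem stateAfter_succ (z : Config N d X) (k : ℕ) :
    stateAfter G W ε z (k + 1) = eventStep G W ε (stateAfter G W ε z k) := by
  rw [stateAfter, stateAfter, iterate_succ_apply']

/-- The dynamics restarted from `z_k` has post-event states `z_{k+m}`. [folklore] -/
theorem stateAfter_stateAfter (z : Config N d X) (k m : ℕ) :
    stateAfter G W ε (stateAfter G W ε z k) m = stateAfter G W ε z (k + m) := by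
  rw [stateAfter, stateAfter, stateAfter, ← iterate_add_apply, add_comm]

/-- `t_0 = 0`. [folklore] -/
@[simp]
theorem eventInstant_zero (z : Config N d X) : eventInstant G W ε z 0 = 0 := by
  simp [eventInstant]

/-- `t_{k+1} = t_k + τ(z_k)`. [folklore] -/
theorem eventInstant_succ (z : Config N d X) (k : ℕ) :
    eventInstant G W ε z (k + 1) = eventInstant G W ε z k + exitTime G W ε (stateAfter G W ε z k) := by
  rw [eventInstant, eventInstant, Finset.sum_range_succ]

/-- `t_1 = τ(z)`. [folklore] -/
@[simp]
theorem eventInstant_one (z : Config N d X) : eventInstant G W ε z 1 = exitTime G W ε z := by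
  simp [eventInstant_succ]

/-- The event instants are nondecreasing in `k`. [folklore] -/
theorem monotone_eventInstant (z : Config N d X) : Monotone (eventInstant G W ε z) := by
  refine monotone_nat_of_le_succ fun k => ?_
  rw [eventInstant_succ]
  exact le_self_add

/-- The event instants of the restarted dynamics: `t_m(z_k) + t_k(z) = t_{k+m}(z)`. [folklore] -/
theorem eventInstant_stateAfter_add (z : Config N d X) (k m : ℕ) :
    eventInstant G W ε z k + eventInstant G W ε (stateAfter G W ε z k) m =
      eventInstant G W ε z (k + m) := by
  induction m with
  | zero => simp
  | succ m ih =>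
    rw [eventInstant_succ, ← add_assoc, ih, stateAfter_stateAfter, ← eventInstant_succ, add_assoc]

/-- Before the first event no event is counted: `eventCount z t = 0` for `t < τ(z)`. [folklore] -/
theorem eventCount_eq_zero_of_lt {z : Config N d X} {t : ℝ} (h : ENNReal.ofReal t < exitTime G W ε z) :
    eventCount G W ε z t = 0 := by
  refine le_antisymm (csSup_le' fun k hk => ?_) (Nat.zero_le _)
  rcases Nat.eq_zero_or_pos k with hk0 | hk0
  · exact hk0.le
  have h1 : eventInstant G W ε z 1 ≤ eventInstant G W ε z k := monotone_eventInstant z hk0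
  rw [eventInstant_one] at h1
  exact ((not_le.2 h) (h1.trans hk)).elim

/-- Up to the first event instant included, no event happened strictly before:
`eventCountBefore z t = 0` for `t ≤ τ(z)`. [folklore] -/
theorem eventCountBefore_eq_zero_of_le {z : Config N d X} {t : ℝ}
    (h : ENNReal.ofReal t ≤ exitTime G W ε z) : eventCountBefore G W ε z t = 0 := by
  refine le_antisymm (csSup_le' fun k hk => ?_) (Nat.zero_le _)
  rcases Nat.eq_zero_or_pos k with hk0 | hk0
  · exact hk0.le
  have h1 : eventInstant G W ε z 1 ≤ eventInstant G W ε z k := monotone_eventInstant z hk0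
  rw [eventInstant_one] at h1
  exact ((not_lt.2 h) (h1.trans_lt hk)).elim

/-- Before the first event the forward flow is free flight: `Φ_t z = S_t z` for `t < τ(z)`. [folklore] -/
theorem fwdFlow_eq_freeFlight_of_lt {z : Config N d X} {t : ℝ} (h : ENNReal.ofReal t < exitTime G W ε z) :
    fwdFlow G W ε z t = freeFlight G t z := by
  simp [fwdFlow, eventCount_eq_zero_of_lt h]

/-- Up to the first event instant included, the left-continuous forward flow is free flight:
`Φ_{t⁻} z = S_t z` for `t ≤ τ(z)`. [folklore] -/
theorem fwdFlowLeft_eq_freeFlight_of_le {z : Config N d X} {t : ℝ}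
    (h : ENNReal.ofReal t ≤ exitTime G W ε z) : fwdFlowLeft G W ε z t = freeFlight G t z := by
  simp [fwdFlowLeft, eventCountBefore_eq_zero_of_le h]

/-- `Φ_0 z = z` as soon as `τ(z) > 0`. [folklore] -/
theorem fwdFlow_zero_of_pos {z : Config N d X} (h : 0 < exitTime G W ε z) : fwdFlow G W ε z 0 = z := by
  rw [fwdFlow_eq_freeFlight_of_lt (by simpa using h), freeFlight_zero]

/-- At nonpositive times the left-continuous forward flow is free flight. [folklore] -/
theorem fwdFlowLeft_of_nonpos {z : Config N d X} {u : ℝ} (hu : u ≤ 0) :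
    fwdFlowLeft G W ε z u = freeFlight G u z :=
  fwdFlowLeft_eq_freeFlight_of_le (by simp [ENNReal.ofReal_of_nonpos hu])

/-- For `t ≥ 0` the flow is the forward flow. [folklore] -/
theorem flow_of_nonneg {t : ℝ} (ht : 0 ≤ t) (z : Config N d X) : flow G W ε t z = fwdFlow G W ε z t := by
  simp [flow, ht]

/-- For `t < 0` the flow is the flipped left-continuous forward flow of the flipped datum. [folklore] -/
theorem flow_of_neg {t : ℝ} (ht : t < 0) (z : Config N d X) :
    flow G W ε t z = flipVel (fwdFlowLeft G W ε (flipVel z) (-t)) := by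
  simp [flow, not_le.2 ht]

/-- `T⁰ z = z` as soon as `τ(z) > 0`. [folklore] -/
theorem flow_zero_of_pos {z : Config N d X} (h : 0 < exitTime G W ε z) : flow G W ε 0 z = z := by
  rw [flow_of_nonneg le_rfl, fwdFlow_zero_of_pos h]

/-- Before the first forward event the flow is free flight: `T^t z = S_t z` for `0 ≤ t < τ(z)`. [folklore] -/
theorem flow_eq_freeFlight_of_lt {z : Config N d X} {t : ℝ} (ht : 0 ≤ t)
    (h : ENNReal.ofReal t < exitTime G W ε z) : flow G W ε t z = freeFlight G t z := by
  rw [flow_of_nonneg ht, fwdFlow_eq_freeFlight_of_lt h]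

/-- Back to the first backward event the flow is free flight: `T^t z = S_t z` for `t < 0` with
`-t ≤ τ(S z)`. [folklore] -/
theorem flow_eq_freeFlight_of_neg {z : Config N d X} {t : ℝ} (ht : t < 0)
    (h : ENNReal.ofReal (-t) ≤ exitTime G W ε (flipVel z)) : flow G W ε t z = freeFlight G t z := by
  rw [flow_of_neg ht, fwdFlowLeft_eq_freeFlight_of_le h, Alexander.flipVel_freeFlight_flipVel, neg_neg]

/-- A datum that never has an event, neither forward nor backward, moves by free flight for all
times. [folklore] -/
theorem flow_eq_freeFlight_of_eq_top {z : Config N d X} (h : exitTime G W ε z = ∞)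
    (h' : exitTime G W ε (flipVel z) = ∞) (t : ℝ) : flow G W ε t z = freeFlight G t z := by
  rcases le_or_gt 0 t with ht | ht
  · exact flow_eq_freeFlight_of_lt ht (h ▸ ENNReal.ofReal_lt_top)
  · exact flow_eq_freeFlight_of_neg ht (h' ▸ le_top)

/-! ## Wall reflections and positions; simple event configurations -/

/-- A simple pair event configuration has an incoming pair in the sense of the wall-free
construction and no wall contact. [folklore] -/
theorem isSimplePairEvent_iff {z : Config N d X} :
    IsSimplePairEvent G W ε z ↔
      Alexander.IsSimpleIncoming G ε z ∧ ∀ (i : Fin N) (k : ι), (z i).1 ∉ (W k).contact :=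
  Iff.rfl

/-- A simple pair event is a simple event. [folklore] -/
theorem IsSimplePairEvent.isSimpleEvent {z : Config N d X} (h : IsSimplePairEvent G W ε z) :
    IsSimpleEvent G W ε z :=
  Or.inl h

/-- A simple wall event is a simple event. [folklore] -/
theorem IsSimpleWallEvent.isSimpleEvent {z : Config N d X} (h : IsSimpleWallEvent G W ε z) :
    IsSimpleEvent G W ε z :=
  Or.inr h

/-- A simple pair event configuration has no incoming wall contact. [folklore] -/
theorem IsSimplePairEvent.incomingWalls_eq_empty {z : Config N d X} (h : IsSimplePairEvent G W ε z) :
    incomingWalls W z = ∅ := by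
  ext q
  simp only [mem_incomingWalls, mem_empty_iff_false, iff_false, not_and]
  exact fun hc _ => h.2 q.1 q.2 hc

/-- A simple wall event configuration has no incoming contact pair. [folklore] -/
theorem IsSimpleWallEvent.incomingPairs_eq_empty {z : Config N d X} (h : IsSimpleWallEvent G W ε z) :
    Alexander.incomingPairs G ε z = ∅ := by
  obtain ⟨q, -, -, -, hno⟩ := h
  ext p
  simp only [Alexander.mem_incomingPairs, mem_empty_iff_false, iff_false, not_and]
  exact fun hp hc _ => hno p.1 p.2 (ne_of_lt hp) hc

/-- WITH NO WALLS the confined exit time is the wall-free exit time. [folklore] -/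
theorem exitTime_of_isEmpty [IsEmpty ι] (z : Config N d X) :
    exitTime G W ε z = Alexander.freeExitTime G ε z := by
  simp [exitTime, Alexander.freeExitTime]

/-- WITH NO WALLS there are no incoming wall contacts. [folklore] -/
theorem incomingWalls_of_isEmpty [IsEmpty ι] (z : Config N d X) : incomingWalls W z = ∅ := by
  ext q
  exact isEmptyElim q.2

/-- WITH NO WALLS the event step is the wall-free collision step. [folklore] -/
theorem eventStep_of_isEmpty [IsEmpty ι] (z : Config N d X) :
    eventStep G W ε z = Alexander.collisionStep G ε z := by
  have hτ : exitTime G W ε z = Alexander.freeExitTime G ε z := exitTime_of_isEmpty z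
  by_cases h : exitTime G W ε z = ∞
  · rw [eventStep_of_eq_top h, Alexander.collisionStep_of_eq_top (hτ ▸ h)]
  · rw [eventStep_of_ne_top h, eventJump, hτ]
    have h' : Alexander.freeExitTime G ε z ≠ ∞ := hτ ▸ h
    simp only [Alexander.collisionStep, h', if_false, incomingWalls_of_isEmpty,
      Set.not_nonempty_empty, dif_neg, not_false_eq_true]

end ConfinedAlexander

end Kinetic

end

end Literature.Analysis.FluidPDE
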